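import Literature.NumberTheory.GaloisRepresentations.OrdinaryGaloisRep
import Literature.NumberTheory.GaloisRepresentations.ResidualGaloisRep
import Literature.NumberTheory.GaloisRepresentations.StableLatticeValuationRing
import Literature.NumberTheory.GaloisRepresentations.GoodDihedralLocalImage
import Literature.RepresentationTheory.Semisimple.FinTwoSemisimplification
import HarnessLib

/-!
# A representation reducible on a subgroup is residually reducible on that subgroup
# (nearly ordinary at `v` ⇒ `ρ̄|_{G_v}` reducible)

Theorems only (no definition of a notion, no named fact; D-0026), written by the seat of the
named fact `Literature.NumberTheory.Automorphic.Allen2014_modularity_nearlyOrdinaryDihedral_Q`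
(P. B. Allen, *Modularity of nearly ordinary 2-adic residually dihedral Galois representations*,
Compositio Math. 150 (2014) = arXiv:1301.1113).  It formalizes the first, standing hypothesis of
Allen's §5.1.1 (arXiv p. 69: "We fix a continuous absolutely irreducible `ρ̄ : G_F → GL₂(𝔽̄)`
such that for each `v ∣ p`, `ρ̄|_{G_v}` is reducible"), as it is met in the proof of the Theorem
of the Introduction: there `ρ̄` is the residual representation of a `ρ : G_F → GL₂(ℚ̄₂)` which
is nearly ordinary at every `v ∣ 2` (hypothesis (2): `ρ|_{G_v} ≅ (∗ ∗ ; 0 χ_v)`), and the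
reducibility of `ρ̄|_{G_v}` is the folklore fact that *a stable line of the generic fibre meets
every stable lattice in a saturated stable sub-lattice* (Serre, *Abelian ℓ-adic representations*
(1968), Ch. I §1.1; Skinner–Wiles, Publ. Math. IHÉS 89 (1999), §4.6, proof of Theorem A: "for some
choice of basis `ρ₁` takes values in `GL₂(𝒪)` … `ρ̄₁ = (1 ∗ ; 0 χ)`").  Over the non-Noetherian
valuation ring `ℤ̄_p` of `ℚ̄_p` (the coefficient ring of the tree's residual representations,
`padicAlgClIntegers`) the saturation argument is done by hand in rank `2`: a non-zero vector of
`F²` is, up to a scalar, a *primitive* vector of `O²` (one coordinate equal to `1`), and a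
primitive vector is the first column of a matrix of `GL₂(O)`.

## Main results (all proved)

* `exists_conjGL_apply_one_zero_eq_zero_of_hasCommonEigenvector_map` — `O ⊆ F` a valuation
  subring, `ρ₀ : G → GL₂(O)` whose generic fibre `ρ₀ ⊗ F` has a common eigenvector: then
  `R⁻¹ ρ₀ R` is upper triangular for some `R ∈ GL₂(O)` (an upper-triangular integral model in an
  `O`-frame, not merely an `F`-frame).
* `hasCommonEigenvector_integralReduction` — hence every reduction `ρ₀ mod 𝔪` (pushed along any
  residue embedding `ι`) has a common eigenvector.
* `IsReductionOf.hasCommonEigenvector_comp`, `IsResidualRepOf.hasCommonEigenvector_comp` — for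
  `ρ : G → GL₂(F)`, a homomorphism `φ : H → G` and a reduction (resp. a residual representation
  = semisimplified reduction) `τ` of `ρ`: if `ρ ∘ φ` has a common eigenvector, so does `τ ∘ φ`.
  The residual case goes through the characteristic polynomials (Brauer–Nesbitt over an
  arbitrary field, the tree's `Representation.nonempty_equiv_of_charpoly_eq`):
  `hasCommonEigenvector_of_charpoly_eq` — a `σ : H → GL₂(k)` with the characteristic polynomials
  of an `H`-representation having a common eigenvector has one (Wiles, Invent. Math. 94 (1988),
  proof of Lemma 2.2.4, p. 565).
* `FramedGaloisRep.IsOrdinaryOfWeight.hasCommonEigenvector`,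
  `FramedGaloisRep.IsOrdinaryOfWeightAt.hasCommonEigenvector_comp_of_isReductionOf`,
  `FramedGaloisRep.IsOrdinaryOfWeightAt.hasCommonEigenvector_comp_of_isResidualRepOf`,
  `FramedGaloisRep.IsOrdinaryOfWeightAt.hasCommonEigenvector_residualRep_comp` — the Galois
  case: if `ρ : Γ_K → GL₂(ℚ̄_p)` is (Skinner–Wiles / nearly) ordinary of some weight at the finite
  place `v` (`IsOrdinaryOfWeightAt p ρ v k m`), then every reduction and every residual
  representation of `ρ`, in particular the tree's chosen `ρ.residualRep`, is reducible on the
  decomposition group at `v` (has a common eigenvector on the image of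
  `Γ_{K_v} → Γ_K`).  This is Allen's standing hypothesis "`ρ̄|_{G_v}` reducible for `v ∣ p`"
  derived from hypothesis (2) of his Introduction Theorem.

## References

* P. B. Allen, Compositio Math. 150 (2014) 1235–1346, §5.1.1 (arXiv:1301.1113, p. 69).
  [Allen2014]
* C. Skinner, A. Wiles, Publ. Math. IHÉS 89 (1999), §4.6, proof of Theorem A. [SkinnerWiles1999]
* A. Wiles, Invent. Math. 94 (1988), 529–573, proof of Lemma 2.2.4, p. 565. [Wiles1988]
* J.-P. Serre, *Abelian ℓ-adic representations and elliptic curves* (1968), Ch. I §1.1.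
  [SerreAbelianLadic1968]
-/

noncomputable section

open scoped MatrixGroups NumberField
open Matrix IsLocalRing Field IsDedekindDomain
open Literature.RepresentationTheory.Semisimple

namespace Literature.NumberTheory.GaloisRepresentations

/-! ### Over a field: frames adapted to a line, conjugation, characteristic polynomials -/

section Field

variable {k : Type*} [Field k] {G : Type*} [Group G]

/-- If every `ρ(g)` has vanishing `(1,0)` entry (upper triangular), `e₀` is a common
eigenvector. [folklore] -/
theorem hasCommonEigenvector_of_apply_one_zero_eq_zero {ρ : G →* GL (Fin 2) k}
    (h : ∀ g, ((ρ g : GL (Fin 2) k) : Matrix (Fin 2) (Fin 2) k) 1 0 = 0) :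
    HasCommonEigenvector ρ := by
  refine ⟨Pi.single 0 1, by simp, fun g => ⟨((ρ g : GL (Fin 2) k) : Matrix (Fin 2) (Fin 2) k) 0 0, ?_⟩⟩
  ext i
  fin_cases i
  · simp [Matrix.mulVec, dotProduct, Fin.sum_univ_two]
  · simp [Matrix.mulVec, dotProduct, Fin.sum_univ_two, h g]

/-- A common eigenvector for `ρ` gives one for every conjugate `P ρ P⁻¹`. [folklore] -/
theorem hasCommonEigenvector_conjGL {ρ : G →* GL (Fin 2) k} (h : HasCommonEigenvector ρ)
    (P : GL (Fin 2) k) : HasCommonEigenvector (conjGL P ρ) := by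
  refine HasCommonEigenvector.of_conjGL (P := P⁻¹) ?_
  have e : conjGL P⁻¹ (conjGL P ρ) = ρ := MonoidHom.ext fun g => by
    rw [conjGL_apply, conjGL_apply]; group
  rwa [e]

/-- `HasCommonEigenvector` only depends on the conjugacy class: if `ρ'(g) = P ρ(g) P⁻¹` for all
`g` and `ρ` has a common eigenvector, so does `ρ'`. [folklore] -/
theorem hasCommonEigenvector_of_forall_eq_conj {ρ ρ' : G →* GL (Fin 2) k}
    (h : HasCommonEigenvector ρ) (P : GL (Fin 2) k) (hρ' : ∀ g, ρ' g = P * ρ g * P⁻¹) :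
    HasCommonEigenvector ρ' := by
  have e : ρ' = conjGL P ρ := MonoidHom.ext fun g => by rw [hρ' g, conjGL_apply]
  rw [e]
  exact hasCommonEigenvector_conjGL h P

/-- A non-zero vector of `k²` is the first column of an invertible matrix. [folklore] -/
theorem exists_generalLinearGroup_mulVec_single_eq {v : Fin 2 → k} (hv : v ≠ 0) :
    ∃ R : GL (Fin 2) k, (R : Matrix (Fin 2) (Fin 2) k) *ᵥ Pi.single 0 1 = v := by
  by_cases h0 : v 0 = 0
  · have h1 : v 1 ≠ 0 := by
      intro h1
      apply hv
      ext i
      fin_cases i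
      · exact h0
      · exact h1
    refine ⟨Matrix.GeneralLinearGroup.mkOfDetNeZero !![v 0, 1; v 1, 0]
      (by rw [Matrix.det_fin_two_of]; simpa using h1), ?_⟩
    ext i
    fin_cases i <;>
      simp [Matrix.GeneralLinearGroup.mkOfDetNeZero, Matrix.mulVec, dotProduct, Fin.sum_univ_two]
  · refine ⟨Matrix.GeneralLinearGroup.mkOfDetNeZero !![v 0, 0; v 1, 1]
      (by rw [Matrix.det_fin_two_of]; simpa using h0), ?_⟩
    ext i
    fin_cases i <;>
      simp [Matrix.GeneralLinearGroup.mkOfDetNeZero, Matrix.mulVec, dotProduct, Fin.sum_univ_two]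

/-- A representation with a common eigenvector is conjugate to an upper-triangular one:
`R⁻¹ ρ R` has vanishing `(1,0)` entries for a frame `R` whose first column is the eigenvector.
[folklore] -/
theorem HasCommonEigenvector.exists_conjGL_apply_one_zero_eq_zero {ρ : G →* GL (Fin 2) k}
    (h : HasCommonEigenvector ρ) :
    ∃ R : GL (Fin 2) k, ∀ g,
      ((Literature.NumberTheory.GaloisRepresentations.conjGL R⁻¹ ρ g : GL (Fin 2) k) :
        Matrix (Fin 2) (Fin 2) k) 1 0 = 0 := by
  obtain ⟨v, hv, key⟩ := h
  obtain ⟨R, hR⟩ := exists_generalLinearGroup_mulVec_single_eq hv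
  refine ⟨R, fun g => ?_⟩
  obtain ⟨a, ha⟩ := key g
  have hRinv : ((R⁻¹ : GL (Fin 2) k) : Matrix (Fin 2) (Fin 2) k) *ᵥ v = Pi.single 0 1 := by
    rw [← hR, Matrix.mulVec_mulVec, ← Matrix.GeneralLinearGroup.coe_mul, inv_mul_cancel,
      Matrix.GeneralLinearGroup.coe_one, Matrix.one_mulVec]
  have hcol : ((conjGL R⁻¹ ρ g : GL (Fin 2) k) : Matrix (Fin 2) (Fin 2) k) *ᵥ Pi.single 0 1 =
      a • Pi.single 0 1 := by
    rw [conjGL_apply, inv_inv, Matrix.GeneralLinearGroup.coe_mul,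
      Matrix.GeneralLinearGroup.coe_mul, ← Matrix.mulVec_mulVec, ← Matrix.mulVec_mulVec, hR, ha,
      Matrix.mulVec_smul, hRinv]
  have := congr_fun hcol 1
  simpa [Matrix.mulVec_single_one] using this

/-- The diagonal of a homomorphism into upper-triangular invertible `2 × 2` matrices is a pair of
characters. [folklore] -/
theorem exists_characters_of_apply_one_zero_eq_zero {U : G →* GL (Fin 2) k}
    (hU : ∀ g, ((U g : GL (Fin 2) k) : Matrix (Fin 2) (Fin 2) k) 1 0 = 0) :
    ∃ χ : G →* kˣ × kˣ, ∀ g,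
      ((χ g).1 : k) = ((U g : GL (Fin 2) k) : Matrix (Fin 2) (Fin 2) k) 0 0 ∧
      ((χ g).2 : k) = ((U g : GL (Fin 2) k) : Matrix (Fin 2) (Fin 2) k) 1 1 := by
  have hdet : ∀ g, ((U g : GL (Fin 2) k) : Matrix (Fin 2) (Fin 2) k) 0 0 *
      ((U g : GL (Fin 2) k) : Matrix (Fin 2) (Fin 2) k) 1 1 ≠ 0 := fun g => by
    have h := (U g).isUnit.map Matrix.detMonoidHom
    rw [Matrix.coe_detMonoidHom, Matrix.det_fin_two, hU g, mul_zero, sub_zero] at h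
    exact h.ne_zero
  have h00 : ∀ g, ((U g : GL (Fin 2) k) : Matrix (Fin 2) (Fin 2) k) 0 0 ≠ 0 := fun g =>
    left_ne_zero_of_mul (hdet g)
  have h11 : ∀ g, ((U g : GL (Fin 2) k) : Matrix (Fin 2) (Fin 2) k) 1 1 ≠ 0 := fun g =>
    right_ne_zero_of_mul (hdet g)
  have hmul00 : ∀ g g', ((U (g * g') : GL (Fin 2) k) : Matrix (Fin 2) (Fin 2) k) 0 0 =
      ((U g : GL (Fin 2) k) : Matrix (Fin 2) (Fin 2) k) 0 0 *
        ((U g' : GL (Fin 2) k) : Matrix (Fin 2) (Fin 2) k) 0 0 := fun g g' => by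
    rw [map_mul, Matrix.GeneralLinearGroup.coe_mul, Matrix.mul_apply, Fin.sum_univ_two, hU g',
      mul_zero, add_zero]
  have hmul11 : ∀ g g', ((U (g * g') : GL (Fin 2) k) : Matrix (Fin 2) (Fin 2) k) 1 1 =
      ((U g : GL (Fin 2) k) : Matrix (Fin 2) (Fin 2) k) 1 1 *
        ((U g' : GL (Fin 2) k) : Matrix (Fin 2) (Fin 2) k) 1 1 := fun g g' => by
    rw [map_mul, Matrix.GeneralLinearGroup.coe_mul, Matrix.mul_apply, Fin.sum_univ_two, hU g,
      zero_mul, zero_add]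
  let f : G → kˣ × kˣ := fun g => (Units.mk0 _ (h00 g), Units.mk0 _ (h11 g))
  have hf : ∀ g g', f (g * g') = f g * f g' := fun g g' =>
    Prod.ext (Units.ext (by simp only [f, Prod.fst_mul, Units.val_mul, Units.val_mk0, hmul00]))
      (Units.ext (by simp only [f, Prod.snd_mul, Units.val_mul, Units.val_mk0, hmul11]))
  exact ⟨MonoidHom.mk' f hf, fun g => ⟨rfl, rfl⟩⟩

/-- **A common eigenvector is detected by characteristic polynomials** (Wiles, Invent. Math. 94
(1988), proof of Lemma 2.2.4, p. 565: "their traces … are equal … and so the two representations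
have isomorphic semisimplifications … Clearly there is [a line] on which the action is via `σ` or
`σ⁻¹ det ρ`").  If `τ : G → GL₂(k)` has a common eigenvector and `σ : G → GL₂(k)` has the same
characteristic polynomials, then `σ` has a common eigenvector: otherwise `σ` is irreducible,
hence semisimple, hence (Brauer–Nesbitt, over any field) equivalent to the sum `χ₁ ⊕ χ₂` of the
diagonal characters of a triangular form of `τ`, which is reducible. [cite: Wiles1988, Lemma 2.2.4 (proof, p. 565)] -/
theorem hasCommonEigenvector_of_charpoly_eq {σ τ : G →* GL (Fin 2) k}
    (hτ : HasCommonEigenvector τ)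
    (h : ∀ g, ((σ g : GL (Fin 2) k) : Matrix (Fin 2) (Fin 2) k).charpoly =
      ((τ g : GL (Fin 2) k) : Matrix (Fin 2) (Fin 2) k).charpoly) :
    HasCommonEigenvector σ := by
  classical
  by_contra hσ
  -- a triangular form `U = R⁻¹ τ R` of `τ` and its diagonal characters
  obtain ⟨R, hU⟩ := hτ.exists_conjGL_apply_one_zero_eq_zero
  set U : G →* GL (Fin 2) k := conjGL R⁻¹ τ with hUdef
  obtain ⟨χ, hχ⟩ := exists_characters_of_apply_one_zero_eq_zero hU
  obtain ⟨Dg, hDg⟩ := Literature.RepresentationTheory.Semisimple.exists_diagonalHom (k := k)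
  set δ : G →* GL (Fin 2) k := Dg.comp χ with hδ
  have hδval : ∀ g, ((δ g : GL (Fin 2) k) : Matrix (Fin 2) (Fin 2) k) =
      Matrix.diagonal ![((χ g).1 : k), ((χ g).2 : k)] := fun g => hDg (χ g)
  -- `σ` and `δ` have the same characteristic polynomials
  have hcp : ∀ g, ((σ g : GL (Fin 2) k) : Matrix (Fin 2) (Fin 2) k).charpoly =
      ((δ g : GL (Fin 2) k) : Matrix (Fin 2) (Fin 2) k).charpoly := fun g => by
    have hUτ : ((U g : GL (Fin 2) k) : Matrix (Fin 2) (Fin 2) k).charpoly =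
        ((τ g : GL (Fin 2) k) : Matrix (Fin 2) (Fin 2) k).charpoly := by
      rw [hUdef, conjGL_apply, inv_inv, Matrix.GeneralLinearGroup.coe_mul,
        Matrix.GeneralLinearGroup.coe_mul, Matrix.coe_units_inv]
      exact Matrix.charpoly_units_conj' R _
    rw [h g, ← hUτ, Matrix.charpoly_fin_two, Matrix.charpoly_fin_two, Matrix.trace_fin_two,
      Matrix.trace_fin_two, Matrix.det_fin_two, Matrix.det_fin_two, hδval, hU g]
    obtain ⟨h0, h1⟩ := hχ g
    simp [h0, h1]
  -- `σ` irreducible (no common eigenvector), hence semisimple; `δ` diagonal, hence semisimple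
  have hirr : (toStdRepresentation σ).IsIrreducible := isIrreducible_of_not_hasCommonEigenvector σ hσ
  haveI : IsSimpleOrder (Subrepresentation (toStdRepresentation σ)) := hirr
  haveI : (toStdRepresentation σ).IsSemisimpleRepresentation :=
    (inferInstance : ComplementedLattice (Subrepresentation (toStdRepresentation σ)))
  haveI : (toStdRepresentation δ).IsSemisimpleRepresentation :=
    Literature.RepresentationTheory.Semisimple.isSemisimpleRepresentation_diagonal_fin_two δ
      fun g => ⟨_, hδval g⟩
  have hcp' : ∀ g, (toStdRepresentation σ g).charpoly = (toStdRepresentation δ g).charpoly := by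
    intro g
    have h1 : toStdRepresentation σ g = Matrix.toLin' ((σ g : GL (Fin 2) k) : Matrix (Fin 2) (Fin 2) k) :=
      LinearMap.ext fun v => by rw [toStdRepresentation_apply_apply, Matrix.toLin'_apply]
    have h2 : toStdRepresentation δ g = Matrix.toLin' ((δ g : GL (Fin 2) k) : Matrix (Fin 2) (Fin 2) k) :=
      LinearMap.ext fun v => by rw [toStdRepresentation_apply_apply, Matrix.toLin'_apply]
    rw [h1, h2, Matrix.charpoly_toLin', Matrix.charpoly_toLin', hcp g]
  obtain ⟨e⟩ := Literature.RepresentationTheory.Semisimple.Representation.nonempty_equiv_of_charpoly_eq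
    (toStdRepresentation σ) (toStdRepresentation δ) hcp'
  haveI : (toStdRepresentation δ).IsIrreducible :=
    Literature.RepresentationTheory.Semisimple.Representation.isIrreducible_of_equiv e
  -- but `δ` is diagonal: `e₀` is a common eigenvector
  exact not_hasCommonEigenvector_of_isIrreducible δ ‹_›
    (hasCommonEigenvector_of_apply_one_zero_eq_zero fun g => by rw [hδval g]; simp)

end Field

/-! ### Over a valuation ring: primitive vectors and integral frames adapted to a line -/

section ValuationSubring

variable {F : Type*} [Field F] {O : ValuationSubring F} {G : Type*} [Group G]

/-- **Primitive representatives of lines** over a valuation subring `O ⊆ F`: a non-zero `u ∈ F²`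
is `c • w` for a scalar `c ≠ 0` and a vector `w ∈ O²` one of whose coordinates is `1` (divide by
a coordinate of maximal valuation: `u₀/u₁ ∈ O` or `u₁/u₀ ∈ O`). [folklore] -/
theorem exists_primitive_of_ne_zero (u : Fin 2 → F) (hu : u ≠ 0) :
    ∃ (c : F) (w : Fin 2 → O), c ≠ 0 ∧ (∀ j, ((w j : O) : F) = c⁻¹ * u j) ∧ (w 0 = 1 ∨ w 1 = 1) := by
  by_cases h0 : u 0 = 0
  · have h1 : u 1 ≠ 0 := by
      intro h1
      apply hu
      ext i
      fin_cases i
      · exact h0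
      · exact h1
    refine ⟨u 1, ![0, 1], h1, fun j => ?_, Or.inr rfl⟩
    fin_cases j
    · simp [h0]
    · simp [h1]
  by_cases h1 : u 1 = 0
  · refine ⟨u 0, ![1, 0], h0, fun j => ?_, Or.inl rfl⟩
    fin_cases j
    · simp [h0]
    · simp [h1]
  rcases O.mem_or_inv_mem (u 0 / u 1) with hx | hx
  · refine ⟨u 1, ![⟨u 0 / u 1, hx⟩, 1], h1, fun j => ?_, Or.inr rfl⟩
    fin_cases j
    · simp [div_eq_inv_mul, mul_comm]
    · simp [h1]
  · refine ⟨u 0, ![1, ⟨(u 0 / u 1)⁻¹, hx⟩], h0, fun j => ?_, Or.inl rfl⟩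
    fin_cases j
    · simp [h0]
    · simp [div_eq_inv_mul, mul_comm]

/-- A primitive vector of `O²` (one coordinate equal to `1`) is the first column of a matrix of
`GL₂(O)`. [folklore] -/
theorem exists_generalLinearGroup_apply_zero_eq (w : Fin 2 → O) (hw : w 0 = 1 ∨ w 1 = 1) :
    ∃ R : GL (Fin 2) O, ∀ i, (R : Matrix (Fin 2) (Fin 2) O) i 0 = w i := by
  rcases hw with h | h
  · refine ⟨Matrix.GeneralLinearGroup.mk'' !![w 0, 0; w 1, 1]
      (by rw [Matrix.det_fin_two_of, h]; simp), fun i => ?_⟩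
    have e : ((Matrix.GeneralLinearGroup.mk'' !![w 0, 0; w 1, 1]
        (by rw [Matrix.det_fin_two_of, h]; simp) : GL (Fin 2) O) : Matrix (Fin 2) (Fin 2) O) =
        !![w 0, 0; w 1, 1] := rfl
    rw [e]
    fin_cases i <;> rfl
  · refine ⟨Matrix.GeneralLinearGroup.mk'' !![w 0, 1; w 1, 0]
      (by rw [Matrix.det_fin_two_of, h]; simp), fun i => ?_⟩
    have e : ((Matrix.GeneralLinearGroup.mk'' !![w 0, 1; w 1, 0]
        (by rw [Matrix.det_fin_two_of, h]; simp) : GL (Fin 2) O) : Matrix (Fin 2) (Fin 2) O) =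
        !![w 0, 1; w 1, 0] := rfl
    rw [e]
    fin_cases i <;> rfl

/-- **A stable line of the generic fibre gives an upper-triangular integral model in an
`O`-frame** (Serre, *Abelian ℓ-adic representations*, I §1.1; Skinner–Wiles 1999, §4.6, proof of
Theorem A: "for some choice of basis `ρ₁` takes values in `GL₂(𝒪)` … `ρ̄₁ = (1 ∗ ; 0 χ)`").  Let
`O ⊆ F` be a valuation subring (no Noetherian hypothesis, e.g. `ℤ̄_p ⊆ ℚ̄_p`) and
`ρ₀ : G → GL₂(O)` such that `ρ₀ ⊗ F` has a common eigenvector.  Then for some `R ∈ GL₂(O)` all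
`R⁻¹ ρ₀(g) R` have vanishing `(1,0)` entry.  (The stable line meets `O²` in the saturated
sub-lattice spanned by a primitive vector `w`, the first column of `R`; the eigenvalue on `w` is
integral because it is a coordinate of `ρ₀(g) w`.) [cite: SkinnerWiles1999, §4.6, proof of Theorem A] -/
theorem exists_conjGL_apply_one_zero_eq_zero_of_hasCommonEigenvector_map (ρ₀ : G →* GL (Fin 2) O)
    (h : HasCommonEigenvector ((Matrix.GeneralLinearGroup.map O.subtype).comp ρ₀)) :
    ∃ R : GL (Fin 2) O, ∀ g,
      ((conjGL R⁻¹ ρ₀ g : GL (Fin 2) O) : Matrix (Fin 2) (Fin 2) O) 1 0 = 0 := by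
  obtain ⟨u, hu, key⟩ := h
  obtain ⟨c, w, hc, hw, hprim⟩ := exists_primitive_of_ne_zero (O := O) u hu
  obtain ⟨R, hR⟩ := exists_generalLinearGroup_apply_zero_eq w hprim
  obtain ⟨i, hi⟩ : ∃ i, w i = 1 := hprim.elim (fun h => ⟨0, h⟩) fun h => ⟨1, h⟩
  refine ⟨R, fun g => ?_⟩
  obtain ⟨a, ha⟩ := key g
  -- notation
  set M : Matrix (Fin 2) (Fin 2) O := ((ρ₀ g : GL (Fin 2) O) : Matrix (Fin 2) (Fin 2) O) with hM
  have hmap : (((Matrix.GeneralLinearGroup.map O.subtype).comp ρ₀ g : GL (Fin 2) F) :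
      Matrix (Fin 2) (Fin 2) F) = M.map O.subtype := rfl
  -- `w`, seen in `F²`, is `c⁻¹ • u`, hence also an eigenvector, with the same eigenvalue `a`
  have hwF : (M.map O.subtype) *ᵥ (fun j => ((w j : O) : F)) = a • fun j => ((w j : O) : F) := by
    have e : (fun j => ((w j : O) : F)) = c⁻¹ • u := funext fun j => by rw [hw j]; rfl
    rw [e, Matrix.mulVec_smul, ← hmap, ha, smul_comm]
  -- the eigenvalue is integral: it is the `i`-th coordinate of `M *ᵥ w`
  set aO : O := (M *ᵥ w) i with haO
  have haO' : ((aO : O) : F) = a := by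
    have h1 := RingHom.map_mulVec O.subtype M w i
    have h2 := congr_fun hwF i
    simp only [Pi.smul_apply, smul_eq_mul, hi, OneMemClass.coe_one, mul_one] at h2
    rw [haO]
    exact (h1.trans (by rw [← h2]; rfl))
  have hO : M *ᵥ w = aO • w := by
    funext j
    apply O.subtype_injective
    have h1 := RingHom.map_mulVec O.subtype M w j
    have h2 := congr_fun hwF j
    simp only [Pi.smul_apply, smul_eq_mul] at h2
    rw [h1]
    change (M.map O.subtype *ᵥ fun j => ((w j : O) : F)) j = O.subtype (aO * w j)
    rw [h2, map_mul, ← haO']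
    rfl
  -- in the frame `R` (first column `w`), `R⁻¹ ρ₀(g) R e₀ = aO • e₀`
  have hRe : (R : Matrix (Fin 2) (Fin 2) O) *ᵥ Pi.single 0 1 = w := by
    rw [Matrix.mulVec_single_one]
    funext j
    exact hR j
  have hRinv : ((R⁻¹ : GL (Fin 2) O) : Matrix (Fin 2) (Fin 2) O) *ᵥ w = Pi.single 0 1 := by
    rw [← hRe, Matrix.mulVec_mulVec, ← Matrix.GeneralLinearGroup.coe_mul, inv_mul_cancel,
      Matrix.GeneralLinearGroup.coe_one, Matrix.one_mulVec]
  have hcol : ((conjGL R⁻¹ ρ₀ g : GL (Fin 2) O) : Matrix (Fin 2) (Fin 2) O) *ᵥ Pi.single 0 1 =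
      aO • Pi.single 0 1 := by
    rw [conjGL_apply, inv_inv, Matrix.GeneralLinearGroup.coe_mul,
      Matrix.GeneralLinearGroup.coe_mul, ← Matrix.mulVec_mulVec, ← Matrix.mulVec_mulVec, hRe,
      ← hM, hO, Matrix.mulVec_smul, hRinv]
  have := congr_fun hcol 1
  simpa [Matrix.mulVec_single_one] using this

/-- **Reductions of a representation with a stable generic line are reducible**: for
`ρ₀ : G → GL₂(O)` with a common eigenvector over `F`, the reduction `ρ₀ mod 𝔪` pushed along any
residue embedding `ι : O/𝔪 → k` has a common eigenvector. [folklore] -/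
theorem hasCommonEigenvector_integralReduction {k : Type*} [Field k] (ι : ResidueField O →+* k)
    (ρ₀ : G →* GL (Fin 2) O)
    (h : HasCommonEigenvector ((Matrix.GeneralLinearGroup.map O.subtype).comp ρ₀)) :
    HasCommonEigenvector (integralReduction ι ρ₀) := by
  obtain ⟨R, hR⟩ := exists_conjGL_apply_one_zero_eq_zero_of_hasCommonEigenvector_map ρ₀ h
  have htri : ∀ g, ((integralReduction ι (conjGL R⁻¹ ρ₀) g : GL (Fin 2) k) :
      Matrix (Fin 2) (Fin 2) k) 1 0 = 0 := fun g => by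
    rw [integralReduction_apply_coe, hR g, map_zero, map_zero]
  refine HasCommonEigenvector.of_conjGL
    (P := Matrix.GeneralLinearGroup.map (ι.comp (residue O)) R⁻¹) ?_
  have e : conjGL (Matrix.GeneralLinearGroup.map (ι.comp (residue O)) R⁻¹) (integralReduction ι ρ₀) =
      integralReduction ι (conjGL R⁻¹ ρ₀) := MonoidHom.ext fun g => by
    simp only [conjGL_apply, integralReduction, MonoidHom.comp_apply, map_mul, map_inv]
  rw [e]
  exact hasCommonEigenvector_of_apply_one_zero_eq_zero htri

/-- **A reduction of a representation reducible on `H` is reducible on `H`** (rank `2`): if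
`τ` is a reduction of `ρ : G → GL₂(F)` (relative to the valuation subring `O` and a residue
embedding `ι`) and `ρ ∘ φ` has a common eigenvector for a homomorphism `φ : H → G`, then
`τ ∘ φ` has a common eigenvector.  (Any integral model, not only an adapted one: the stable line
of `F²` is there for every lattice.) [folklore] -/
theorem IsReductionOf.hasCommonEigenvector_comp {k : Type*} [Field k] {ι : ResidueField O →+* k}
    {ρ : G →* GL (Fin 2) F} {τ : G →* GL (Fin 2) k} (hτ : IsReductionOf ι ρ τ)
    {H : Type*} [Group H] (φ : H →* G) (hH : HasCommonEigenvector (ρ.comp φ)) :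
    HasCommonEigenvector (τ.comp φ) := by
  obtain ⟨ρ₀, Q, ⟨P, hP⟩, hQ⟩ := hτ
  have h0 : HasCommonEigenvector ((Matrix.GeneralLinearGroup.map O.subtype).comp (ρ₀.comp φ)) :=
    hasCommonEigenvector_of_forall_eq_conj hH P⁻¹ fun x => by
      rw [MonoidHom.comp_apply, MonoidHom.comp_apply, hP, MonoidHom.comp_apply, inv_inv]
  have h1 := hasCommonEigenvector_integralReduction ι (ρ₀.comp φ) h0
  refine hasCommonEigenvector_of_forall_eq_conj h1 Q fun x => ?_
  rw [MonoidHom.comp_apply, hQ]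
  rfl

/-- **A residual representation of a representation reducible on `H` is reducible on `H`**
(rank `2`): same as `IsReductionOf.hasCommonEigenvector_comp` for a residual representation
`σ` (= a semisimplification of a reduction), through the equality of characteristic polynomials
(`hasCommonEigenvector_of_charpoly_eq`, Brauer–Nesbitt). [folklore] -/
theorem IsResidualRepOf.hasCommonEigenvector_comp {k : Type*} [Field k] {ι : ResidueField O →+* k}
    {ρ : G →* GL (Fin 2) F} {σ : G →* GL (Fin 2) k} (hσ : IsResidualRepOf ι ρ σ)
    {H : Type*} [Group H] (φ : H →* G) (hH : HasCommonEigenvector (ρ.comp φ)) :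
    HasCommonEigenvector (σ.comp φ) := by
  obtain ⟨τ, hτ, _, hcp, _⟩ := hσ
  exact hasCommonEigenvector_of_charpoly_eq (hτ.hasCommonEigenvector_comp φ hH) fun x => hcp (φ x)

end ValuationSubring

/-! ### The Galois case: ordinary at `v` ⇒ residually reducible at `v` -/

section GaloisLocal

variable {L : Type*} [Field L] [ValuativeRel L] [TopologicalSpace L] [IsNonarchimedeanLocalField L]
variable {A : Type*} [Field A] [TopologicalSpace A]
variable {p : ℕ} [Fact p.Prime] [Algebra ℤ_[p] A]

/-- An ordinary (of some weight) representation of a local Galois group has a common eigenvector: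
the first vector of an ordinary frame. [folklore] -/
theorem FramedGaloisRep.IsOrdinaryOfWeight.hasCommonEigenvector {ρ : FramedGaloisRep L A 2}
    {k m : ℕ} (h : FramedGaloisRep.IsOrdinaryOfWeight p ρ k m) :
    HasCommonEigenvector (ρ : absoluteGaloisGroup L →* GL (Fin 2) A) := by
  obtain ⟨Q, hQ⟩ := h
  refine HasCommonEigenvector.of_conjGL (P := Q⁻¹)
    (hasCommonEigenvector_of_apply_one_zero_eq_zero fun σ => ?_)
  rw [conjGL_apply, inv_inv]
  exact (hQ σ).1

end GaloisLocal

section GaloisGlobal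

variable {K : Type*} [Field K] [NumberField K]
variable {A : Type*} [Field A] [TopologicalSpace A]
variable {p : ℕ} [Fact p.Prime] [Algebra ℤ_[p] A]

/-- Ordinary of some weight at the finite place `v` ⇒ a common eigenvector on the decomposition
group at `v` (the image of `Γ_{K_v} → Γ_K`). [folklore] -/
theorem FramedGaloisRep.IsOrdinaryOfWeightAt.hasCommonEigenvector_comp {ρ : FramedGaloisRep K A 2}
    {v : HeightOneSpectrum (𝓞 K)} {k m : ℕ} (h : FramedGaloisRep.IsOrdinaryOfWeightAt p ρ v k m) :
    HasCommonEigenvector ((ρ : absoluteGaloisGroup K →* GL (Fin 2) A).comp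
      (absGaloisRestrict K (v.adicCompletion K)).toMonoidHom) :=
  FramedGaloisRep.IsOrdinaryOfWeight.hasCommonEigenvector h

end GaloisGlobal

section PadicAlgCl

variable {K : Type*} [Field K] [NumberField K]
variable {p : ℕ} [Fact p.Prime]

/-- **Nearly ordinary at `v` ⇒ every reduction is reducible at `v`** (Allen 2014, §5.1.1, the
standing hypothesis "for each `v ∣ p`, `ρ̄|_{G_v}` is reducible", as met by the `ρ` of the
Theorem of the Introduction, hypothesis (2)): if `ρ : Γ_K → GL₂(ℚ̄_p)` is ordinary of some weight
at `v` (`IsOrdinaryOfWeightAt`), every reduction `τ` of `ρ` (along any residue embedding) has a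
common eigenvector on the decomposition group at `v`.
[cite: Allen2014, §5.1.1 (arXiv:1301.1113, p. 69)] -/
theorem FramedGaloisRep.IsOrdinaryOfWeightAt.hasCommonEigenvector_comp_of_isReductionOf
    {ρ : FramedGaloisRep K (PadicAlgCl p) 2} {v : HeightOneSpectrum (𝓞 K)} {k m : ℕ}
    (h : FramedGaloisRep.IsOrdinaryOfWeightAt p ρ v k m) {κ : Type*} [Field κ]
    {ι : padicAlgClResidueField p →+* κ} {τ : absoluteGaloisGroup K →* GL (Fin 2) κ}
    (hτ : ρ.IsReductionOf ι τ) :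
    HasCommonEigenvector (τ.comp (absGaloisRestrict K (v.adicCompletion K)).toMonoidHom) :=
  GaloisRepresentations.IsReductionOf.hasCommonEigenvector_comp hτ _ h.hasCommonEigenvector_comp

/-- **Nearly ordinary at `v` ⇒ every residual representation is reducible at `v`** (Allen 2014,
§5.1.1; semisimplified reductions, through Brauer–Nesbitt).
[cite: Allen2014, §5.1.1 (arXiv:1301.1113, p. 69)] -/
theorem FramedGaloisRep.IsOrdinaryOfWeightAt.hasCommonEigenvector_comp_of_isResidualRepOf
    {ρ : FramedGaloisRep K (PadicAlgCl p) 2} {v : HeightOneSpectrum (𝓞 K)} {k m : ℕ}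
    (h : FramedGaloisRep.IsOrdinaryOfWeightAt p ρ v k m) {κ : Type*} [Field κ]
    {ι : padicAlgClResidueField p →+* κ} {σ : absoluteGaloisGroup K →* GL (Fin 2) κ}
    (hσ : ρ.IsResidualRepOf ι σ) :
    HasCommonEigenvector (σ.comp (absGaloisRestrict K (v.adicCompletion K)).toMonoidHom) :=
  GaloisRepresentations.IsResidualRepOf.hasCommonEigenvector_comp hσ _ h.hasCommonEigenvector_comp

/-- **Residual representations exist in rank two** (the hypothesis of `residualRep_spec`):
`Γ_K` is compact, so `ρ : Γ_K → GL₂(ℚ̄_p)` has an integral model over the open valuation ring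
`ℤ̄_p` (`exists_integralModel_of_valuationSubring`), whose reduction has a semisimplification
(`exists_semisimplification_fin_two`). [folklore] -/
theorem FramedGaloisRep.exists_isResidualRepOf_fin_two (ρ : FramedGaloisRep K (PadicAlgCl p) 2) :
    ∃ τ, ρ.IsResidualRepOf (RingHom.id _) τ := by
  have hOopen : IsOpen ((padicAlgClIntegers p : ValuationSubring (PadicAlgCl p)) :
      Set (PadicAlgCl p)) :=
    Valued.isOpen_valuationSubring _
  obtain ⟨P, ρ₀, hρ₀⟩ :=
    exists_integralModel_of_valuationSubring (O := padicAlgClIntegers p) hOopen ρ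
  obtain ⟨τ, hss, hcp, hker⟩ :=
    exists_semisimplification_fin_two (integralReduction (RingHom.id _) ρ₀)
  exact ⟨τ, integralReduction (RingHom.id _) ρ₀, ⟨ρ₀, 1, ⟨P, hρ₀⟩, fun g => by simp⟩,
    hss, hcp, hker⟩

/-- The tree's chosen residual representation `ρ.residualRep` of a rank-two
`ρ : Γ_K → GL₂(ℚ̄_p)` is a residual representation of `ρ` (no junk value in rank `2`). [folklore] -/
theorem FramedGaloisRep.isResidualRepOf_residualRep_fin_two (ρ : FramedGaloisRep K (PadicAlgCl p) 2) :
    ρ.IsResidualRepOf (RingHom.id _) ρ.residualRep :=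
  ρ.residualRep_spec ρ.exists_isResidualRepOf_fin_two

/-- **Nearly ordinary at `v` ⇒ `ρ̄|_{Γ_{K_v}}` reducible** for the tree's residual representation
`ρ.residualRep : Γ_K → GL₂(ℤ̄_p/𝔪)` (Allen 2014, §5.1.1: "for each `v ∣ p`, `ρ̄|_{G_v}` is
reducible", from hypothesis (2) of the Theorem of the Introduction).
[cite: Allen2014, §5.1.1 (arXiv:1301.1113, p. 69)] -/
theorem FramedGaloisRep.IsOrdinaryOfWeightAt.hasCommonEigenvector_residualRep_comp
    {ρ : FramedGaloisRep K (PadicAlgCl p) 2} {v : HeightOneSpectrum (𝓞 K)} {k m : ℕ}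
    (h : FramedGaloisRep.IsOrdinaryOfWeightAt p ρ v k m) :
    HasCommonEigenvector (ρ.residualRep.comp (absGaloisRestrict K (v.adicCompletion K)).toMonoidHom) :=
  h.hasCommonEigenvector_comp_of_isResidualRepOf ρ.isResidualRepOf_residualRep_fin_two

end PadicAlgCl

end Literature.NumberTheory.GaloisRepresentations
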